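import Literature.NumberTheory.EllipticCurves.ModularDegreeFormulaProofs
import Literature.NumberTheory.EllipticCurves.HeightCovolumeBoundsRankinSelbergProofs
import Literature.NumberTheory.EllipticCurves.RootNumberTwistProofs
import Literature.NumberTheory.EllipticCurves.LFunctionSmulProofs
import Literature.NumberTheory.EllipticCurves.EichlerShimuraConstructionProofs
import Literature.NumberTheory.EllipticCurves.ComplexPeriod
import Mathlib.FieldTheory.IsAlgClosed.Basic
import HarnessLib

/-!
# The modular degree of a quadratic twist at an additive prime: `deg φ_{E*} · c_E² = p · deg φ_E · c_{E*}²`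
# (Watkins 2002, §2.1; Delaunay 2003, Thm 1; Pal 2012, Lemma 3.1) — proved

A proofs-only file (theorems only: no definition, no named fact; D-0026), formalising the printed
argument of M. Watkins, *Computing the modular degree of an elliptic curve*, Experiment. Math. **11**
(2002), §2.1 "Quadratic Twists and Minimality", p. 491: "We write
`deg φ_E = deg φ_F · (c_E²/c_F²) · ∏_p V_p` … `V_p = (Ω_{E_p}/Ω_E)·(N_E/N_{E_p})·L^A_p(Sym² E_p, 2)^{-1}`
… Finally, if `E_p` has additive reduction at `p`, then the twisting does not change the
`L`-function or the conductor, but does increase the volume by a factor of `p`, thus decreasing the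
modular degree by `V_p = p`" (there `F = E_p` is the `p`-minimal twist, `E = F ⊗ χ_{p̃}`,
`p̃ = ±p ≡ 1 (4)`, and `c_E`, `c_F` are the Manin constants).  The three printed ingredients are
theorems of the tree:

* Zagier's formula `4π² c² (f, f) = deg(φ) · covol(Λ_E)` for every parametrisation datum
  (`ModularParametrizationData.zagier_degree_formula_holds`; Zagier, Canad. Math. Bull. 28 (1985)
  §1 = Delaunay, J. Théor. Nombres Bordeaux 15 (2003), display (1), p. 674);
* Rankin's residue `Res_{w=2} Σ |aₙ|² n^{-w} = 48π (f, f)/ψ(N)` at every level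
  (`tendsto_sub_two_mul_tsum_normSq_cuspCoeff_div_rpow`), whence **two cusp forms of the same level
  with `|aₙ(g)| = |aₙ(f)|` for all `n` have the same Petersson norm**
  (`peterssonProduct_re_eq_of_norm_cuspCoeff_eq`) — the content of Delaunay 2003, Thm 1 in the
  equal-level case (p. 675, proof: "if `ord_p(N′) = ord_p(N)` then we have
  `L(Sym²ᵢ f′, s) = L(Sym²ᵢ f, s)`", with `‖f‖²_N = (N/8π³) L(Sym²ᵢ f, 2)`, p. 674);
* the coefficients of the twist `E ⊗ χ_{p*}`: `aₙ(E*) = (n/p) aₙ(E)` for `p ∤ n`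
  (`WeierstrassCurve.LFunction_quadraticTwist_pStar_apply`) and `aₙ = 0` for `p ∣ n` at an additive
  prime (`WeierstrassCurve.LFunction_apply_eq_zero_of_hasAdditiveReductionAt`); and the Néron lattice
  of a model with `(c₄, c₆) ↦ (d² c₄, d³ c₆)` is `Λ/√d`, of covolume `covol(Λ)/|d|`
  (`IsNeronLatticeOf.covolume_eq_div_of_c₄_eq_of_c₆_eq`; Pal, Proc. AMS 140 (2012) Lemma 3.1,
  "`ω(E^d) = ω(E)/√d`", with Remark 2.3 `c₄(E^d) = c₄(E) d²`, `c₆(E^d) = c₆(E) d³`).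

Main theorem (`ModularParametrizationData.deg_mul_sq_mul_sq_eq_of_quadraticTwist_pStar`): for
`W / ℚ` elliptic, an odd prime `p` with `aₙ(W) = 0` whenever `p ∣ n` (additive reduction at `p`), a
model `W' = C • (W ⊗ χ_{p*})` of the twist by `p* = (−1)^{(p−1)/2} p` with the same vanishing, and
parametrisation data `D`, `D'` of `W`, `W'` at a common level `N`:

  `D'.deg · D.c² · u(C)² = p · D.deg · D'.c²`.

When `|u(C)| = 1` — e.g. `W` globally minimal of Kodaira type II, III or IV at `p ≥ 5` and `W'` the
minimal model of the twist, where no re-minimalisation occurs (Pal 2012, Prop. 2.4/2.5 (Connell):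
`v_p(Δ') = v_p(Δ) + 6`, `ũ = 1`) — this is Watkins' `V_p = p`:
`D'.deg · D.c² = p · D.deg · D'.c²` (`…_of_abs_u_eq_one`), so `v_p(c') − v_p(c) =
(v_p(deg') − v_p(deg) − 1)/2`; in particular **if `deg' = p · deg` then `|c'| = |c|`**
(`natAbs_c_eq_of_deg_eq`) and `p ∣ c ↔ p ∣ c'` (`dvd_c_iff_of_deg_eq`).  Nothing is claimed about
`c = c'` in general (Watkins: "if we assume the Manin constants are the same").

## References

* [Watkins2002] M. Watkins, *Computing the modular degree of an elliptic curve*, Experiment. Math.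
  11 (2002), no. 4, 487–502, §2.1 (p. 491).
* [Delaunay2003] C. Delaunay, *Computing modular degrees using L-functions*, J. Théor. Nombres
  Bordeaux 15 (2003), 673–682, (1) p. 674 and Thm 1 p. 675.
* [Pal2012] V. Pal, *Periods of quadratic twists of elliptic curves*, Proc. Amer. Math. Soc. 140
  (2012), 1513–1525, Remark 2.3, Prop. 2.4/2.5, Lemma 3.1.
* [ZagierCMB1985] D. Zagier, *Modular parametrizations of elliptic curves*, Canad. Math. Bull. 28
  (1985), §1 (p. 374).
-/

noncomputable section

open scoped MatrixGroups ModularForm Real Topology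
open Filter CongruenceSubgroup IsDedekindDomain IsDedekindDomain.HeightOneSpectrum NumberField
  Rat.HeightOneSpectrum

namespace Literature.NumberTheory.EllipticCurves.ModularForms

/-! ### Equal coefficient sizes ⇒ equal Petersson norms (Delaunay 2003, Thm 1, equal-level case) -/

/-- **Two weight-`2` cusp forms on `Γ₀(N)` with `|aₙ(g)| = |aₙ(f)|` for all `n` have the same
Petersson norm**: both norms are `ψ(N) R/(48π)` for the common Rankin residue
`R = lim_{w→2⁺} (w − 2) Σ |aₙ|² n^{-w}` (`tendsto_sub_two_mul_tsum_normSq_cuspCoeff_div_rpow`,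
`peterssonProduct_re_eq_of_tendsto_div_rpow`).  This is Delaunay's Theorem 1 in the case
`ord_p(N′) = ord_p(N)` ("then we have `L(Sym²ᵢ f′, s) = L(Sym²ᵢ f, s)`", p. 675, with
`‖f‖²_N = (N/8π³) L(Sym²ᵢ f, 2)`, p. 674). [cite: Delaunay2003, Thm 1 (p. 675) with (2) and the Rankin display (p. 674)] -/
theorem peterssonProduct_re_eq_of_norm_cuspCoeff_eq {N : ℕ} [NeZero N]
    (f g : CuspForm (Gamma0 N) 2) (h : ∀ n : ℕ, ‖cuspCoeff g n‖ = ‖cuspCoeff f n‖) :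
    (peterssonProduct (Gamma0 N) 2 g g).re = (peterssonProduct (Gamma0 N) 2 f f).re := by
  have hf := tendsto_sub_two_mul_tsum_normSq_cuspCoeff_div_rpow f
  have hfun : (fun w : ℝ ↦ (w - 2) * ∑' n : ℕ, ‖cuspCoeff g n‖ ^ 2 / (n : ℝ) ^ w) =
      (fun w : ℝ ↦ (w - 2) * ∑' n : ℕ, ‖cuspCoeff f n‖ ^ 2 / (n : ℝ) ^ w) := by
    funext w
    simp_rw [h]
  have hg : Tendsto (fun w : ℝ ↦ (w - 2) * ∑' n : ℕ, ‖cuspCoeff g n‖ ^ 2 / (n : ℝ) ^ w) (𝓝[>] 2)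
      (𝓝 (48 * π * (peterssonProduct (Gamma0 N) 2 f f).re / gamma0Index N)) := by
    rw [hfun]
    exact hf
  have key := peterssonProduct_re_eq_of_tendsto_div_rpow g hg
  have hπ : (π : ℝ) ≠ 0 := Real.pi_ne_zero
  have hψ : (gamma0Index N : ℝ) ≠ 0 := by exact_mod_cast (gamma0Index_pos N).ne'
  rw [key]
  field_simp

/-! ### The Néron lattice of a model with `(c₄, c₆) ↦ (d² c₄, d³ c₆)` (Pal 2012, Lemma 3.1) -/

/-- **`Λ(W') = Λ(W)/√d` when `c₄(W') = d² c₄(W)`, `c₆(W') = d³ c₆(W)`**, in covolume form: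
`covol Λ(W') = covol Λ(W) / |d|` for any Néron-type period pairs of the two models over `ℂ`
(`g₂(cΛ) = c⁻⁴ g₂(Λ)`, `g₃(cΛ) = c⁻⁶ g₃(Λ)` with `c = 1/√d`; a lattice is determined by `(g₂, g₃)`,
`IsNeronLatticeOf.lattice_eq`; `covol(cΛ) = |c|² covol(Λ)`).  Pal 2012, Lemma 3.1:
"`ω(E^d) = ω(E)/√d`" with Remark 2.3. [cite: Pal2012, Lemma 3.1 and Remark 2.3] -/
theorem IsNeronLatticeOf.covolume_eq_div_of_c₄_eq_of_c₆_eq {W W' : WeierstrassCurve ℂ}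
    {d : ℂ} (hd : d ≠ 0) (h4 : W'.c₄ = d ^ 2 * W.c₄) (h6 : W'.c₆ = d ^ 3 * W.c₆)
    {L L' : PeriodPair} (hL : IsNeronLatticeOf W L) (hL' : IsNeronLatticeOf W' L') :
    ZLattice.covolume L'.lattice = ZLattice.covolume L.lattice / ‖d‖ := by
  obtain ⟨s, hs⟩ := IsAlgClosed.exists_pow_nat_eq d zero_lt_two
  have hs0 : s ≠ 0 := by
    rintro rfl
    exact hd (by rw [← hs]; simp)
  have hsi : s⁻¹ ≠ 0 := inv_ne_zero hs0
  -- `L'' = s⁻¹ Λ` is a Néron-type pair of `W'`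
  have hL'' : IsNeronLatticeOf W' (L.mulLeft s⁻¹ hsi) := by
    constructor
    · rw [PeriodPair.g₂_mulLeft, hL.1, h4, ← hs, inv_pow, inv_inv]
      ring
    · rw [PeriodPair.g₃_mulLeft, hL.2, h6, ← hs, inv_pow, inv_inv]
      ring
  rw [hL'.lattice_eq hL'', PeriodPair.covolume_mulLeft_lattice, norm_inv, ← hs, norm_pow, inv_pow]
  field_simp

/-! ### Dirichlet coefficients: additive primes and the twist by `p*` -/

/-- **`aₙ(W) = 0` for `p ∣ n` when `W` has neither good nor multiplicative reduction at `p`**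
(additive reduction, by the local trichotomy; then `WeierstrassCurve.LFunction_apply_eq_zero_of_hasAdditiveReductionAt`).
Hypotheses in the form of the cell's predicate `Addv W p`. [cite: SilvermanAEC2009, VII.5 Prop. 5.1 and App. C §16] -/
theorem _root_.WeierstrassCurve.LFunction_apply_eq_zero_of_not_good_of_not_mult
    (W : WeierstrassCurve ℚ) [W.IsElliptic] (p : ℕ) [Fact p.Prime]
    (hng : ¬ W.HasGoodReductionAtPrime p) (hnm : ¬ W.HasMultiplicativeReductionAtPrime p)
    {n : ℕ} (hn : p ∣ n) : W.LFunction n = 0 := by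
  have hp : p.Prime := Fact.out
  obtain ⟨v, hv⟩ : ∃ v : HeightOneSpectrum (𝓞 ℚ), primesEquiv v = ⟨p, hp⟩ :=
    ⟨(primesEquiv (R := 𝓞 ℚ)).symm ⟨p, hp⟩, Equiv.apply_symm_apply _ _⟩
  have hvp : (primesEquiv v : ℕ) = p := by rw [hv]
  have hgood := W.hasGoodReductionAtPrime_iff_hasGoodReductionAt_ringOfIntegers v
  have hmult := W.hasMultiplicativeReductionAtPrime_iff_hasMultiplicativeReductionAt_ringOfIntegers v
  rw [hv] at hgood hmult
  have hadd : W.HasAdditiveReductionAt v := by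
    rcases W.hasGoodReductionAt_or_hasMultiplicativeReductionAt_or_hasAdditiveReductionAt v with
      h | h | h
    · exact absurd (hgood.mpr h) hng
    · exact absurd (hmult.mpr h) hnm
    · exact h
  exact W.LFunction_apply_eq_zero_of_hasAdditiveReductionAt hvp hadd hn

/-- **`|aₙ(W ⊗ χ_{p*})| = |aₙ(W)|` for all `n`** when both `W` and its twist by
`p* = (−1)^{(p−1)/2} p` (`p` odd) have vanishing coefficients at the multiples of `p` (additive
reduction at `p` on both sides — Watkins' case "`E_p` has additive reduction at `p`", where "the
twisting does not change the `L`-function" of `Sym²`): away from `p`, `aₙ(W*) = (n/p) aₙ(W)`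
(`LFunction_quadraticTwist_pStar_apply`) and `(n/p) = ±1`. [cite: Watkins2002, §2.1 (p. 491)] -/
theorem _root_.WeierstrassCurve.natAbs_LFunction_quadraticTwist_pStar_eq_of_apply_eq_zero
    (W : WeierstrassCurve ℚ) [W.IsElliptic] {p : ℕ} [Fact p.Prime] (hp2 : p ≠ 2)
    (hW : ∀ n : ℕ, p ∣ n → W.LFunction n = 0)
    (hW' : ∀ n : ℕ, p ∣ n → (W.quadraticTwist (((-1 : ℤ) ^ (p / 2) * p : ℤ) : ℚ)).LFunction n = 0)
    (n : ℕ) :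
    ((W.quadraticTwist (((-1 : ℤ) ^ (p / 2) * p : ℤ) : ℚ)).LFunction n).natAbs = (W.LFunction n).natAbs := by
  by_cases hpn : p ∣ n
  · rw [hW n hpn, hW' n hpn]
  · rw [W.LFunction_quadraticTwist_pStar_apply hp2 hpn, Int.natAbs_mul]
    have hne : ((n : ℤ) : ZMod p) ≠ 0 := by
      rw [Int.cast_natCast, Ne, ZMod.natCast_eq_zero_iff]
      exact hpn
    rcases legendreSym.eq_one_or_neg_one p hne with h | h <;> simp [h]

namespace ModularParametrizationData

variable {W W' : WeierstrassCurve ℚ} [W.IsElliptic] {N : ℕ} [NeZero N]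

omit [W.IsElliptic] in
/-- Real form of Zagier's formula: `deg · covol(Λ) = 4π² c² · Re(f, f)`. [cite: ZagierCMB1985, §1 (p. 374)] -/
theorem deg_mul_covolume_eq_re (D : ModularParametrizationData W N) :
    (D.deg : ℝ) * ZLattice.covolume D.L.lattice =
      4 * π ^ 2 * (D.c : ℝ) ^ 2 * (peterssonProduct (Gamma0 N) 2 D.f D.f).re := by
  have h := congrArg Complex.re D.zagier_degree_formula_holds
  rw [Complex.re_ofReal_mul, Complex.ofReal_re] at h
  exact h.symm

/-- **Watkins 2002, §2.1 (additive case `V_p = p`), model form.** Let `W / ℚ` be elliptic, `p` an odd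
prime with `aₙ(W) = 0` for `p ∣ n`, `W' = C • (W ⊗ χ_{p*})` a model of the twist by
`p* = (−1)^{(p−1)/2} p` with `aₙ(W') = 0` for `p ∣ n`, and `D`, `D'` parametrisation data of `W`, `W'`
at a common level `N`. Then `D'.deg · D.c² · u(C)² = p · D.deg · D'.c²`.  Proof = the printed one:
Zagier's formula for both data, `(f', f') = (f, f)` since `|aₙ(W')| = |aₙ(W)|` (Rankin; Delaunay
Thm 1), and `covol Λ(W') = u² covol Λ(W)/p` (the twist scales `(c₄, c₆)` by `(p*², p*³)`, the change
of variables by `(u⁻⁴, u⁻⁶)`). [cite: Watkins2002, §2.1 (p. 491)] -/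
theorem deg_mul_sq_mul_sq_eq_of_quadraticTwist_pStar {p : ℕ} [Fact p.Prime] (hp2 : p ≠ 2)
    (C : WeierstrassCurve.VariableChange ℚ)
    (hW' : C • W.quadraticTwist (((-1 : ℤ) ^ (p / 2) * p : ℤ) : ℚ) = W')
    (hW0 : ∀ n : ℕ, p ∣ n → W.LFunction n = 0) (hW'0 : ∀ n : ℕ, p ∣ n → W'.LFunction n = 0)
    (D : ModularParametrizationData W N) (D' : ModularParametrizationData W' N) :
    (D'.deg : ℝ) * (D.c : ℝ) ^ 2 * ((C.u : ℚ) : ℝ) ^ 2 = p * D.deg * (D'.c : ℝ) ^ 2 := by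
  have hp : p.Prime := Fact.out
  set d : ℤ := (-1 : ℤ) ^ (p / 2) * p with hd
  have hdabs : ‖((d : ℚ) : ℂ)‖ = p := by
    rw [hd]
    push_cast
    rw [norm_mul, norm_pow, norm_neg, norm_one, one_pow, one_mul, Complex.norm_natCast]
  have hd0 : ((d : ℚ) : ℂ) ≠ 0 := by
    intro h
    rw [h, norm_zero] at hdabs
    exact hp.ne_zero (by exact_mod_cast hdabs.symm)
  set T := W.quadraticTwist ((d : ℤ) : ℚ) with hT
  haveI : T.IsElliptic := W.isElliptic_quadraticTwist (by exact_mod_cast hd0 : ((d : ℤ) : ℚ) ≠ 0)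
  -- (1) coefficient sizes agree
  have hT0 : ∀ n : ℕ, p ∣ n → T.LFunction n = 0 := by
    intro n hn
    have := hW'0 n hn
    rwa [← hW', WeierstrassCurve.LFunction_smul] at this
  have hcoef : ∀ n : ℕ, ‖cuspCoeff D'.f n‖ = ‖cuspCoeff D.f n‖ := by
    intro n
    rw [D'.isNewformOf.2 n, D.isNewformOf.2 n, Complex.norm_intCast, Complex.norm_intCast]
    have hsm : W'.LFunction n = T.LFunction n := by rw [← hW', WeierstrassCurve.LFunction_smul]
    rw [hsm]
    have key := congrArg (fun m : ℕ ↦ (m : ℝ))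
      (W.natAbs_LFunction_quadraticTwist_pStar_eq_of_apply_eq_zero hp2 hW0 hT0 n)
    simp only [Nat.cast_natAbs, Int.cast_abs] at key
    exact key
  -- (2) equal Petersson norms
  have hP : (peterssonProduct (Gamma0 N) 2 D'.f D'.f).re = (peterssonProduct (Gamma0 N) 2 D.f D.f).re :=
    peterssonProduct_re_eq_of_norm_cuspCoeff_eq D.f D'.f hcoef
  -- (3) covolumes: `covol Λ(W') = u² · covol Λ(T) = u² · covol Λ(W) / p`
  -- the invariants of the twisted model over `ℂ`
  have h4 : (T.baseChange ℂ).c₄ = ((d : ℚ) : ℂ) ^ 2 * (W.baseChange ℂ).c₄ := by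
    simp only [hT, WeierstrassCurve.baseChange, WeierstrassCurve.map_c₄,
      WeierstrassCurve.quadraticTwist_c₄, map_mul, map_pow, eq_ratCast, Rat.cast_intCast]
  have h6 : (T.baseChange ℂ).c₆ = ((d : ℚ) : ℂ) ^ 3 * (W.baseChange ℂ).c₆ := by
    simp only [hT, WeierstrassCurve.baseChange, WeierstrassCurve.map_c₆,
      WeierstrassCurve.quadraticTwist_c₆, map_mul, map_pow, eq_ratCast, Rat.cast_intCast]
  obtain ⟨LT, hLT⟩ : ∃ LT : PeriodPair, IsNeronLatticeOf (T.baseChange ℂ) LT := by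
    obtain ⟨s, hs⟩ := IsAlgClosed.exists_pow_nat_eq ((d : ℚ) : ℂ) zero_lt_two
    have hs0 : s ≠ 0 := by
      rintro rfl
      exact hd0 (by rw [← hs]; simp)
    refine ⟨D.L.mulLeft s⁻¹ (inv_ne_zero hs0), ?_, ?_⟩
    · rw [PeriodPair.g₂_mulLeft, D.isNeronLattice.1, h4, ← hs, inv_pow, inv_inv]
      ring
    · rw [PeriodPair.g₃_mulLeft, D.isNeronLattice.2, h6, ← hs, inv_pow, inv_inv]
      ring
  have hcovT : ZLattice.covolume LT.lattice = ZLattice.covolume D.L.lattice / p := by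
    rw [IsNeronLatticeOf.covolume_eq_div_of_c₄_eq_of_c₆_eq hd0 h4 h6 D.isNeronLattice hLT, hdabs]
  have hD'L : IsNeronLatticeOf ((C • T).baseChange ℂ) D'.L := by rw [hW']; exact D'.isNeronLattice
  have hcov' : ZLattice.covolume D'.L.lattice =
      ((C.u : ℚ) : ℝ) ^ 2 * (ZLattice.covolume D.L.lattice / p) := by
    rw [IsNeronLatticeOf.lattice_eq_mulLeft_of_smul C hLT hD'L, PeriodPair.covolume_mulLeft_lattice,
      hcovT]
    congr 1
    rw [show (((C.u : ℚ) : ℂ)) = ((((C.u : ℚ) : ℝ)) : ℂ) by norm_cast, Complex.norm_real,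
      Real.norm_eq_abs, sq_abs]
  -- (4) Zagier for both data, and the algebra
  have hZ := D.deg_mul_covolume_eq_re
  have hZ' := D'.deg_mul_covolume_eq_re
  rw [hcov', hP] at hZ'
  have hcov0 : ZLattice.covolume D.L.lattice ≠ 0 := (ZLattice.covolume_pos _ _).ne'
  have hp0 : (p : ℝ) ≠ 0 := by exact_mod_cast hp.ne_zero
  have key : (D'.deg : ℝ) * (((C.u : ℚ) : ℝ) ^ 2 * (ZLattice.covolume D.L.lattice / p)) * (D.c : ℝ) ^ 2 =
      (D'.c : ℝ) ^ 2 * ((D.deg : ℝ) * ZLattice.covolume D.L.lattice) := by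
    rw [hZ', hZ]
    ring
  have e : ZLattice.covolume D.L.lattice / (p : ℝ) * p = ZLattice.covolume D.L.lattice :=
    div_mul_cancel₀ _ hp0
  have key' : ((D'.deg : ℝ) * (D.c : ℝ) ^ 2 * ((C.u : ℚ) : ℝ) ^ 2) * ZLattice.covolume D.L.lattice =
      ((p : ℝ) * D.deg * (D'.c : ℝ) ^ 2) * ZLattice.covolume D.L.lattice := by
    calc ((D'.deg : ℝ) * (D.c : ℝ) ^ 2 * ((C.u : ℚ) : ℝ) ^ 2) * ZLattice.covolume D.L.lattice
        = ((D'.deg : ℝ) * (D.c : ℝ) ^ 2 * ((C.u : ℚ) : ℝ) ^ 2) *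
            (ZLattice.covolume D.L.lattice / (p : ℝ) * p) := by rw [e]
      _ = ((D'.deg : ℝ) * (((C.u : ℚ) : ℝ) ^ 2 * (ZLattice.covolume D.L.lattice / p)) * (D.c : ℝ) ^ 2) *
            p := by ring
      _ = ((D'.c : ℝ) ^ 2 * ((D.deg : ℝ) * ZLattice.covolume D.L.lattice)) * p := by rw [key]
      _ = ((p : ℝ) * D.deg * (D'.c : ℝ) ^ 2) * ZLattice.covolume D.L.lattice := by ring
  exact mul_right_cancel₀ hcov0 key'

/-- **Watkins' `V_p = p` for Manin constants taken on models with `|u| = 1`** (e.g. both models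
globally minimal and no re-minimalisation under the twist — Pal 2012, Prop. 2.4/2.5: `ũ = 1` when
`min{3v_p(c₄), 2v_p(c₆), v_p(Δ)} < 6`, i.e. Kodaira type II, III, IV at `p ≥ 5`):
`D'.deg · D.c² = p · D.deg · D'.c²` in `ℤ`. [cite: Watkins2002, §2.1 (p. 491)] [cite: Pal2012, Prop. 2.5 and Lemma 3.1] -/
theorem deg_mul_sq_eq_of_quadraticTwist_pStar_of_abs_u_eq_one {p : ℕ} [Fact p.Prime] (hp2 : p ≠ 2)
    (C : WeierstrassCurve.VariableChange ℚ)
    (hW' : C • W.quadraticTwist (((-1 : ℤ) ^ (p / 2) * p : ℤ) : ℚ) = W') (hu : |(C.u : ℚ)| = 1)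
    (hW0 : ∀ n : ℕ, p ∣ n → W.LFunction n = 0) (hW'0 : ∀ n : ℕ, p ∣ n → W'.LFunction n = 0)
    (D : ModularParametrizationData W N) (D' : ModularParametrizationData W' N) :
    (D'.deg : ℤ) * D.c ^ 2 = p * D.deg * D'.c ^ 2 := by
  have h := deg_mul_sq_mul_sq_eq_of_quadraticTwist_pStar hp2 C hW' hW0 hW'0 D D'
  have hu2 : ((C.u : ℚ) : ℝ) ^ 2 = 1 := by
    rw [← sq_abs, ← Rat.cast_abs, hu, Rat.cast_one, one_pow]
  rw [hu2, mul_one] at h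
  exact_mod_cast h

/-- **If the degree goes up by exactly `p`, the Manin constants have the same absolute value**:
under the hypotheses of `deg_mul_sq_eq_of_quadraticTwist_pStar_of_abs_u_eq_one`, `D'.deg = p · D.deg`
forces `|D'.c| = |D.c|` (Watkins: "The modular degree goes up by `p` upon twisting" exactly when the
Manin constants agree up to sign). [cite: Watkins2002, §2.1 (p. 491)] -/
theorem natAbs_c_eq_of_deg_eq_of_quadraticTwist_pStar {p : ℕ} [Fact p.Prime] (hp2 : p ≠ 2)
    (C : WeierstrassCurve.VariableChange ℚ)
    (hW' : C • W.quadraticTwist (((-1 : ℤ) ^ (p / 2) * p : ℤ) : ℚ) = W') (hu : |(C.u : ℚ)| = 1)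
    (hW0 : ∀ n : ℕ, p ∣ n → W.LFunction n = 0) (hW'0 : ∀ n : ℕ, p ∣ n → W'.LFunction n = 0)
    (D : ModularParametrizationData W N) (D' : ModularParametrizationData W' N)
    (hdeg : D'.deg = p * D.deg) : D'.c.natAbs = D.c.natAbs := by
  have h := deg_mul_sq_eq_of_quadraticTwist_pStar_of_abs_u_eq_one hp2 C hW' hu hW0 hW'0 D D'
  rw [hdeg, Nat.cast_mul, mul_assoc, mul_assoc] at h
  have hp0 : ((p : ℕ) : ℤ) * D.deg ≠ 0 :=
    mul_ne_zero (by exact_mod_cast (Fact.out : p.Prime).ne_zero) (by exact_mod_cast D.deg_pos.ne')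
  have hsq : D.c ^ 2 = D'.c ^ 2 := by
    have h' : ((p : ℤ) * D.deg) * D.c ^ 2 = ((p : ℤ) * D.deg) * D'.c ^ 2 := by linear_combination h
    exact mul_left_cancel₀ hp0 h'
  exact (Int.natAbs_eq_iff_sq_eq.mpr hsq.symm)

/-- **Transfer of the `p`-part of the Manin constant across the twist**: under the same hypotheses,
`p ∣ D.c ↔ p ∣ D'.c`. [cite: Watkins2002, §2.1 (p. 491)] -/
theorem dvd_c_iff_of_deg_eq_of_quadraticTwist_pStar {p : ℕ} [Fact p.Prime] (hp2 : p ≠ 2)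
    (C : WeierstrassCurve.VariableChange ℚ)
    (hW' : C • W.quadraticTwist (((-1 : ℤ) ^ (p / 2) * p : ℤ) : ℚ) = W') (hu : |(C.u : ℚ)| = 1)
    (hW0 : ∀ n : ℕ, p ∣ n → W.LFunction n = 0) (hW'0 : ∀ n : ℕ, p ∣ n → W'.LFunction n = 0)
    (D : ModularParametrizationData W N) (D' : ModularParametrizationData W' N)
    (hdeg : D'.deg = p * D.deg) : (p : ℤ) ∣ D.c ↔ (p : ℤ) ∣ D'.c := by
  have h := natAbs_c_eq_of_deg_eq_of_quadraticTwist_pStar hp2 C hW' hu hW0 hW'0 D D' hdeg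
  rw [Int.natCast_dvd, Int.natCast_dvd, h]

/-! ### Models with the same `(c₄, c₆)`: the change of variables has `u = 1` -/

omit [W.IsElliptic] in
/-- **Two Weierstrass models over `ℚ` with the same `c₄` and `c₆` differ by a change of variables
with `u = 1`**: both are carried by Mathlib's `toShortNF` (which has `u = 1`) to the short model
`y² = x³ − (c₄/48) x − c₆/864` (Silverman, *AEC* III.1, `c₄ = −48 a₄`, `c₆ = −864 a₆` in short
form). [cite: SilvermanAEC2009, III.1 (short Weierstrass form)] -/
theorem _root_.WeierstrassCurve.exists_variableChange_u_eq_one_of_c₄_eq_of_c₆_eq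
    (W W' : WeierstrassCurve ℚ) (h4 : W'.c₄ = W.c₄) (h6 : W'.c₆ = W.c₆) :
    ∃ C : WeierstrassCurve.VariableChange ℚ, (C.u : ℚ) = 1 ∧ C • W = W' := by
  have hu : ∀ X : WeierstrassCurve ℚ, (X.toShortNF.u : ℚ) = 1 := fun X ↦ by
    simp [WeierstrassCurve.toShortNF, WeierstrassCurve.toCharNeTwoNF,
      WeierstrassCurve.VariableChange.mul_def]
  -- the two short normal forms coincide
  have hS : W.toShortNF • W = W'.toShortNF • W' := by
    have h4S : (W.toShortNF • W).c₄ = (W'.toShortNF • W').c₄ := by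
      rw [WeierstrassCurve.variableChange_c₄, WeierstrassCurve.variableChange_c₄, h4]
      simp [hu]
    have h6S : (W.toShortNF • W).c₆ = (W'.toShortNF • W').c₆ := by
      rw [WeierstrassCurve.variableChange_c₆, WeierstrassCurve.variableChange_c₆, h6]
      simp [hu]
    rw [WeierstrassCurve.c₄_of_isShortNF, WeierstrassCurve.c₄_of_isShortNF] at h4S
    rw [WeierstrassCurve.c₆_of_isShortNF, WeierstrassCurve.c₆_of_isShortNF] at h6S
    ext
    · rw [WeierstrassCurve.a₁_of_isShortNF, WeierstrassCurve.a₁_of_isShortNF]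
    · rw [WeierstrassCurve.a₂_of_isShortNF, WeierstrassCurve.a₂_of_isShortNF]
    · rw [WeierstrassCurve.a₃_of_isShortNF, WeierstrassCurve.a₃_of_isShortNF]
    · linarith
    · linarith
  refine ⟨W'.toShortNF⁻¹ * W.toShortNF, ?_, ?_⟩
  · simp [WeierstrassCurve.VariableChange.mul_def, WeierstrassCurve.VariableChange.inv_def, hu]
  · rw [mul_smul, hS, ← mul_smul, inv_mul_cancel, one_smul]

/-- **Watkins' `V_p = p` from the invariants alone.** If `W' / ℚ` has `c₄(W') = p*² c₄(W)` and
`c₆(W') = p*³ c₆(W)` (`p* = (−1)^{(p−1)/2} p`, `p` odd) — e.g. `W` globally minimal of Kodaira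
type II, III or IV at `p ≥ 5` and `W'` any globally minimal model of `W ⊗ χ_{p*}` (no
re-minimalisation: Pal 2012, Prop. 2.4/2.5, `ũ = 1`; two minimal models have the same `c₄, c₆`) —
and `aₙ(W) = aₙ(W') = 0` for `p ∣ n`, then for parametrisation data `D`, `D'` at a common level
`D'.deg · D.c² = p · D.deg · D'.c²`. (`W'` and `W ⊗ χ_{p*}` have the same `(c₄, c₆)`, hence differ by
a change of variables with `u = 1`.) [cite: Watkins2002, §2.1 (p. 491)] [cite: Pal2012, Remark 2.3, Prop. 2.5 and Lemma 3.1] -/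
theorem deg_mul_sq_eq_of_c₄_eq_of_c₆_eq {p : ℕ} [Fact p.Prime] (hp2 : p ≠ 2)
    (h4 : W'.c₄ = ((((-1 : ℤ) ^ (p / 2) * p : ℤ) : ℚ)) ^ 2 * W.c₄)
    (h6 : W'.c₆ = ((((-1 : ℤ) ^ (p / 2) * p : ℤ) : ℚ)) ^ 3 * W.c₆)
    (hW0 : ∀ n : ℕ, p ∣ n → W.LFunction n = 0) (hW'0 : ∀ n : ℕ, p ∣ n → W'.LFunction n = 0)
    (D : ModularParametrizationData W N) (D' : ModularParametrizationData W' N) :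
    (D'.deg : ℤ) * D.c ^ 2 = p * D.deg * D'.c ^ 2 := by
  set T := W.quadraticTwist ((((-1 : ℤ) ^ (p / 2) * p : ℤ) : ℚ)) with hT
  have h4' : W'.c₄ = T.c₄ := by rw [h4, hT, WeierstrassCurve.quadraticTwist_c₄]
  have h6' : W'.c₆ = T.c₆ := by rw [h6, hT, WeierstrassCurve.quadraticTwist_c₆]
  obtain ⟨C, hu, hC⟩ := T.exists_variableChange_u_eq_one_of_c₄_eq_of_c₆_eq W' h4' h6'
  exact deg_mul_sq_eq_of_quadraticTwist_pStar_of_abs_u_eq_one hp2 C hC (by rw [hu, abs_one])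
    hW0 hW'0 D D'

/-- `|c'| = |c|` when `deg' = p · deg`, invariants form (see `deg_mul_sq_eq_of_c₄_eq_of_c₆_eq`).
[cite: Watkins2002, §2.1 (p. 491)] -/
theorem natAbs_c_eq_of_deg_eq_of_c₄_eq_of_c₆_eq {p : ℕ} [Fact p.Prime] (hp2 : p ≠ 2)
    (h4 : W'.c₄ = ((((-1 : ℤ) ^ (p / 2) * p : ℤ) : ℚ)) ^ 2 * W.c₄)
    (h6 : W'.c₆ = ((((-1 : ℤ) ^ (p / 2) * p : ℤ) : ℚ)) ^ 3 * W.c₆)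
    (hW0 : ∀ n : ℕ, p ∣ n → W.LFunction n = 0) (hW'0 : ∀ n : ℕ, p ∣ n → W'.LFunction n = 0)
    (D : ModularParametrizationData W N) (D' : ModularParametrizationData W' N)
    (hdeg : D'.deg = p * D.deg) : D'.c.natAbs = D.c.natAbs := by
  have h := deg_mul_sq_eq_of_c₄_eq_of_c₆_eq hp2 h4 h6 hW0 hW'0 D D'
  rw [hdeg, Nat.cast_mul, mul_assoc, mul_assoc] at h
  have hp0 : ((p : ℕ) : ℤ) * D.deg ≠ 0 :=
    mul_ne_zero (by exact_mod_cast (Fact.out : p.Prime).ne_zero) (by exact_mod_cast D.deg_pos.ne')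
  have hsq : D.c ^ 2 = D'.c ^ 2 := by
    have h' : ((p : ℤ) * D.deg) * D.c ^ 2 = ((p : ℤ) * D.deg) * D'.c ^ 2 := by linear_combination h
    exact mul_left_cancel₀ hp0 h'
  exact (Int.natAbs_eq_iff_sq_eq.mpr hsq.symm)

/-- `p ∣ c ↔ p ∣ c'` when `deg' = p · deg`, invariants form: **the `p`-part of the Manin constant
transfers across the twist by `p*` at an additive prime** (the form used with Cremona's degree
table, where `deg(E ⊗ χ_{p*}) = p · deg(E)` is read off per pair). [cite: Watkins2002, §2.1 (p. 491)] -/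
theorem dvd_c_iff_of_deg_eq_of_c₄_eq_of_c₆_eq {p : ℕ} [Fact p.Prime] (hp2 : p ≠ 2)
    (h4 : W'.c₄ = ((((-1 : ℤ) ^ (p / 2) * p : ℤ) : ℚ)) ^ 2 * W.c₄)
    (h6 : W'.c₆ = ((((-1 : ℤ) ^ (p / 2) * p : ℤ) : ℚ)) ^ 3 * W.c₆)
    (hW0 : ∀ n : ℕ, p ∣ n → W.LFunction n = 0) (hW'0 : ∀ n : ℕ, p ∣ n → W'.LFunction n = 0)
    (D : ModularParametrizationData W N) (D' : ModularParametrizationData W' N)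
    (hdeg : D'.deg = p * D.deg) : (p : ℤ) ∣ D.c ↔ (p : ℤ) ∣ D'.c := by
  have h := natAbs_c_eq_of_deg_eq_of_c₄_eq_of_c₆_eq hp2 h4 h6 hW0 hW'0 D D' hdeg
  rw [Int.natCast_dvd, Int.natCast_dvd, h]

end ModularParametrizationData

end Literature.NumberTheory.EllipticCurves.ModularForms

end
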